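import Summits.HodgeConjecture.HodgeConjecture.Theses.GenericDivisibility
import Summits.HodgeConjecture.HodgeConjecture.Theorems.GenericDivisibilityHodgeClassesGenericallyDivisibleBirationalDescent
import Summits.HodgeConjecture.HodgeConjecture.Theorems.GenericDivisibilityGenericDivisibilityBoundedBirationalUp
import Summits.HodgeConjecture.HodgeConjecture.Theorems.GenericDivisibilityGenericDivisibilityBoundedHeartDescent
import Literature.AlgebraicGeometry.HodgeTheory.ComplexGysinHodgeType
import Literature.AlgebraicGeometry.HodgeTheory.HodgeTypeConjugation
import Literature.NumberTheory.Transcendental.DeRhamTheoremMultiplicative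
import HarnessLib

/-!
# Route GenericDivisibility — crux C1 `HodgeClassesGenericallyDivisible` (stmt-HodgeConjecture-18466)
# ASCENDS along birational morphisms granted the route's `TorsionDiesGenerically`; within the route
# C1 is a birational invariant

`σ : X' ⟶ X` is a `ℂ`-morphism of smooth projective `2p`-folds with `σ.left` birational (an
isomorphism over a dense open `U ⊆ X`), `f = σ(ℂ)`, `H = H²ᵖ(–(ℂ); ℤ)`, `z| = z|_{(X∖Z)(ℂ)}`, "`x ∈ GT`"
(generically torsion): `N • x| = 0` on the complex points of some non-empty Zariski open, `N ≥ 1`.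
"C1 at `X`": every `z ∈ H²ᵖ(X(ℂ);ℤ)` with `z ⊗ ℂ` of type `(p,p)` is, for every `m ≥ 1`, an
`m`-multiple on the complex points of some non-empty Zariski open.

The companion file `…BirationalDescent` proved, unconditionally, that C1 at `X'` implies C1 at `X`.
Here: **C1 at `X` implies C1 at `X'`, granted the route's support item `TorsionDiesGenerically`**
(stmt-HodgeConjecture-18850, Colliot-Thélène–Voisin 2012 Thm. 3.1 / Bloch–Kato, applied once, on `X'`).
So within the route (which carries `TorsionDiesGenerically` anyway) C1 is a birational invariant of
smooth projective `2p`-folds, like the Hodge conjecture itself and like the companion crux C2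
(`stub_cruxAtOfBirationalUp` + `stub_cruxAtOfSurjective`).

## The argument

Let `G = σ_! : H²ᵖ(X'(ℂ);ℤ) → H²ᵖ(X(ℂ);ℤ)` be the integral Gysin map for the complex orientations
(degree one: `G σ^* = id`), `z = G z'`, `κ = z' - σ^* z`, so `G κ = 0`.
* `κ ∈ GT(X')` — part (A) of `…BirationalUp` verbatim (`κ ⊗ ℂ` dies on `(σ⁻¹U)(ℂ)`, so lies in
  `N¹(X')`, so `κ` is generically torsion); by `TorsionDiesGenerically` on `X'`, `κ` then DIES on the
  complex points of a smaller non-empty Zariski open. (Over `ℤ` this is the only place a hypothesis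
  enters: the tree's Gysin maps live on compact manifolds, so `κ|_{(σ⁻¹U)(ℂ)} = 0` integrally — true,
  by proper base change — is not available, only its torsion shadow.)
* `z ⊗ ℂ` is of type `(p,p)`: `(G z') ⊗ ℂ = c • σ_*^ℂ (z' ⊗ ℂ)` for the complex Gysin map of the
  tree's `complexOrientationFamily` (`genericDivisibilityBounded_ringChange_gysinMap_eq_smul`), and
  complex Gysin maps of morphisms of smooth projective varieties of the same dimension have bidegree
  `(0,0)` on Hodge types (Voisin I §7.3.2, the tree's `isOfHodgeType_complexGysin` fed with the proved
  facts `hodgePQ_independent_of_hodgeModel_holds`, `nonempty_hodgeModel_holds`,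
  `exists_deRhamIsoFamily_holds`).
* C1 at `X` for `z`, pulled back along the surjection `σ` (`genericDivisibilityBounded_divisible_map`):
  `m • y₁ = (σ^* z)|` off `σ⁻¹Z_m`; and `z' = σ^* z + κ` with `κ| = 0` off `E₂`; intersect the opens.

* `hodgeClassesGenericallyDivisible_at_of_isBirational_up_of_torsionDiesGenerically` — the theorem;
* `hodgeClassesGenericallyDivisible_iff_of_isBirational_of_torsionDiesGenerically` — C1 at `X'` iff
  C1 at `X`, granted `TorsionDiesGenerically`;
* `stub_hodgeClassesGenericallyDivisible_of_isBirational_up` — the registered sub-goal of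
  stmt-HodgeConjecture-18466, closed form.

References: [VoisinHodgeI2002] §7.3.2 Lemma 7.28, proof of Thm. 7.31; [Fulton1998] Lemma 19.1.2;
[FultonYoungTableaux1997] App. B §B.1 (5)–(7); [ColliotTheleneVoisin2012] Thm. 3.1, Prop. 3.4;
[HatcherAT2002] §3.3 Thm. 3.30; [SGA1] XII Prop. 3.1 (xi).
-/

set_option linter.dupNamespace false

noncomputable section

namespace Summit.HodgeConjecture.HodgeConjecture.Theorems

open CategoryTheory AlgebraicGeometry
open Literature.AlgebraicGeometry.Motives Literature.AlgebraicGeometry.HodgeTheory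
  Literature.AlgebraicTopology.SingularHomology
open Summit.HodgeConjecture.HodgeConjecture.Theses.GenericDivisibility (TorsionDiesGenerically)

/-- Restriction `H^k(X(ℂ);ℤ) → H^k((X∖Z)(ℂ);ℤ)`, the very term of the route decls (notation only). -/
local notation3 (prettyPrint := false) "Res[" X ", " Z ", " k "]" =>
  singularCohomology.map ℤ ℤ
    (⟨Subtype.val, continuous_subtype_val⟩ : C(complexPointsCompl X Z, ComplexPoints X)) k

/-- The inclusion `(X ∖ Z')(ℂ) ↪ (X ∖ Z)(ℂ)` for `h : Z ⊆ Z'`, spelled as in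
`genericDivisibility_restrict_restrict` (notation only). -/
local notation3 (prettyPrint := false) "Incl[" X ", " Z ", " Z' ", " h "]" =>
  (⟨fun P : complexPointsCompl X Z' => (⟨P.1, fun hP : P.1.pt ∈ Z => P.2 (h hP)⟩ :
      complexPointsCompl X Z),
    continuous_subtype_val.subtype_mk fun (P : complexPointsCompl X Z') (hP : P.1.pt ∈ Z) =>
      P.2 (h hP)⟩ : C(complexPointsCompl X Z', complexPointsCompl X Z))

variable {p : ℕ} {X' X : SchemeOver ℂ}

/-- **The integral Gysin map of a morphism of smooth projective varieties of the same dimension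
preserves the Hodge type `(a, b)` of complexifications.** For `f : X' ⟶ X` between smooth projective
`n`-folds and `u ∈ H^k(X'(ℂ);ℤ)` with `u ⊗ ℂ` of type `(a, b)`, the class `(f_! u) ⊗ ℂ` is of type
`(a, b)`, `f_! = gysinMap` for the complex `ℤ`-orientations: `(f_! u) ⊗ ℂ = c • f_*^ℂ(u ⊗ ℂ)` for the
complex Gysin map of `complexOrientationFamily` (`genericDivisibilityBounded_ringChange_gysinMap_eq_smul`),
which has bidegree `(0,0)` on Hodge types (Voisin I §7.3.2, `isOfHodgeType_complexGysin` with the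
tree's proved facts). [cite: VoisinHodgeI2002, §7.3.2 (with Lemma 7.30)]
[cite: FultonYoungTableaux1997, Appendix B §B.1 (5)] -/
theorem isOfHodgeType_ringChange_gysinMap_complexOrientationInt {n : ℕ}
    (hX' : IsSmoothProjective n X') (hX : IsSmoothProjective n X) (f : X' ⟶ X) {k q a b : ℕ}
    (h : k + q = 2 * n) (u : singularCohomology ℤ ℤ (ComplexPoints X') k)
    (hu : IsOfHodgeType n X' k a b
      (singularCohomology.ringChange (Int.castRingHom ℂ) (ComplexPoints X') k u)) :
    letI := hX.chartedSpace
    letI := hX'.chartedSpace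
    IsOfHodgeType n X k a b
      (singularCohomology.ringChange (Int.castRingHom ℂ) (ComplexPoints X) k
        (gysinMap (complexOrientationInt hX') (complexOrientationInt hX)
          (AlgPoints.mapContinuous (L := ℂ) f) h h u)) := by
  letI := hX.chartedSpace
  letI := hX'.chartedSpace
  haveI := ComplexPoints.compactSpace_of_isSmoothProjective hX
  haveI := ComplexPoints.compactSpace_of_isSmoothProjective hX'
  haveI := ComplexPoints.t2Space_of_isSmoothProjective hX
  haveI := ComplexPoints.t2Space_of_isSmoothProjective hX'
  haveI := connectedSpace_complexPoints hX'
  haveI := connectedSpace_complexPoints hX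
  have hν'PD : (complexOrientationFamily hX).HasPoincareDuality := fun _ _ h' ↦ poincare_duality _ h'
  obtain ⟨c, -, hc⟩ := genericDivisibilityBounded_ringChange_gysinMap_eq_smul
    (complexOrientationInt hX') (complexOrientationInt hX) (complexOrientationFamily hX')
    (complexOrientationFamily hX) hν'PD (AlgPoints.mapContinuous (L := ℂ) f) h h
  rw [hc u, ← complexGysin_eq_gysinMap hX' hX f (show k + 2 * n = k + 2 * n from rfl) h h]
  exact IsOfHodgeType.smul (isOfHodgeType_complexGysin hodgePQ_independent_of_hodgeModel_holds
    (fun _ _ ↦ nonempty_hodgeModel_holds)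
    (fun E _ _ _ ↦ Literature.NumberTheory.Transcendental.exists_deRhamIsoFamily_holds E)
    complexOrientationFamily hX' hX f (show k + 2 * n = k + 2 * n from rfl) (p := a) (q := b)
    (p' := a) (q' := b) rfl rfl hu) c

/-- **C1 ascends along birational morphisms of smooth projective `2p`-folds, granted
`TorsionDiesGenerically`.** Let `σ : X' ⟶ X` be birational between smooth projective `2p`-folds
(`p ≥ 1`) and suppose C1 holds at `X` (every integral `(p,p)`-class of degree `2p` is generically
`m`-divisible for every `m ≥ 1`). Then C1 holds at `X'`. With `G = σ_!` (integral, degree one),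
`z = G z'`, `κ = z' - σ^* z`: `G κ = 0`, so `κ ⊗ ℂ ∈ N¹(X')` and `κ` is generically torsion (part (A)
of `…BirationalUp`), hence generically ZERO by `TorsionDiesGenerically` on `X'`; `z ⊗ ℂ` is of type
`(p,p)` (`isOfHodgeType_ringChange_gysinMap_complexOrientationInt`), so C1 at `X` applies to `z` and
pulls back along the surjection `σ`; finally `z' = σ^* z + κ` on the intersection of the two opens.
[cite: VoisinHodgeI2002, §7.3.2 Lemma 7.28 and proof of Thm. 7.31] [cite: Fulton1998, Lemma 19.1.2]
[cite: ColliotTheleneVoisin2012, Thm. 3.1 and Prop. 3.4] -/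
theorem hodgeClassesGenericallyDivisible_at_of_isBirational_up_of_torsionDiesGenerically
    (hT : TorsionDiesGenerically) (hp : 1 ≤ p) (hX' : IsSmoothProjective (2 * p) X')
    (hX : IsSmoothProjective (2 * p) X) (σ : X' ⟶ X)
    (hσ : Literature.AlgebraicGeometry.Resolution.IsBirational σ.left)
    (hC : ∀ z : singularCohomology ℤ ℤ (ComplexPoints X) (2 * p),
      IsOfHodgeType (2 * p) X (2 * p) p p
          (singularCohomology.ringChange (Int.castRingHom ℂ) (ComplexPoints X) (2 * p) z) →
        ∀ m : ℕ, 1 ≤ m → ∃ Z : Set X.left, IsClosed Z ∧ Z ≠ Set.univ ∧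
          ∃ y : singularCohomology ℤ ℤ (complexPointsCompl X Z) (2 * p), m • y = Res[X, Z, 2 * p] z)
    (z' : singularCohomology ℤ ℤ (ComplexPoints X') (2 * p))
    (hz' : IsOfHodgeType (2 * p) X' (2 * p) p p
      (singularCohomology.ringChange (Int.castRingHom ℂ) (ComplexPoints X') (2 * p) z'))
    {m : ℕ} (hm : 1 ≤ m) :
    ∃ Z : Set X'.left, IsClosed Z ∧ Z ≠ Set.univ ∧
      ∃ y : singularCohomology ℤ ℤ (complexPointsCompl X' Z) (2 * p), m • y = Res[X', Z, 2 * p] z' := by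
  letI := hX.chartedSpace
  letI := hX'.chartedSpace
  haveI := ComplexPoints.compactSpace_of_isSmoothProjective hX
  haveI := ComplexPoints.compactSpace_of_isSmoothProjective hX'
  haveI := ComplexPoints.t2Space_of_isSmoothProjective hX
  haveI := ComplexPoints.t2Space_of_isSmoothProjective hX'
  haveI : IsIntegral X'.left := IsSmoothProjective.isIntegral_holds hX'
  haveI : IsIntegral X.left := IsSmoothProjective.isIntegral_holds hX
  haveI : IsProper σ.left := isProper_left_of_isSmoothProjective hX' hX σ
  have hsurj : Function.Surjective σ.left.base := surjective_base_of_isBirational σ.left hσ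
  have hσ' := hσ
  obtain ⟨U, -, hU', hiso⟩ := hσ'
  haveI : IsIso (σ.left ∣_ U) := hiso
  have h2 : 2 * p + 2 * p = 2 * (2 * p) := by ring
  -- the integral Gysin map `G = σ_!`, of degree one; `z = G z'`, `κ = z' - σ^* z`, `G κ = 0`
  have hPDℤ : (complexOrientationInt hX).HasPoincareDuality := fun _ _ h' ↦ poincare_duality _ h'
  have hdegℤ := hasDegree_one_complexOrientationInt_of_isBirational hX' hX σ hσ
  set z : singularCohomology ℤ ℤ (ComplexPoints X) (2 * p) :=
    gysinMap (complexOrientationInt hX') (complexOrientationInt hX)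
      (AlgPoints.mapContinuous (L := ℂ) σ) h2 h2 z' with hz
  set κ : singularCohomology ℤ ℤ (ComplexPoints X') (2 * p) :=
    z' - singularCohomology.map ℤ ℤ (AlgPoints.mapContinuous (L := ℂ) σ) (2 * p) z with hκ
  have hGκ : gysinMap (complexOrientationInt hX') (complexOrientationInt hX)
      (AlgPoints.mapContinuous (L := ℂ) σ) h2 h2 κ = 0 := by
    rw [hκ, map_sub, hz, gysinMap_map_of_hasDegree hPDℤ hdegℤ h2, one_smul, sub_self]
  -- (A) `κ ⊗ ℂ ∈ N¹(X')`, hence `κ ∈ GT(X')` (part (A) of `…BirationalUp`)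
  obtain ⟨μ, ν, hdeg⟩ := exists_hasDegree_one_of_isBirational hX' hX σ hσ
  have hA := genericDivisibilityBounded_restrictCompl_eq_zero_of_gysinMap_eq_zero hX' hX σ hσ U μ ν
    hdeg h2 _ (genericDivisibilityBounded_gysinMap_ringChange_eq_zero hX' hX
      (AlgPoints.mapContinuous (L := ℂ) σ) μ ν h2 κ hGκ)
  have hE : IsClosed (σ.left.base ⁻¹' (U : Set X.left)ᶜ) :=
    U.2.isClosed_compl.preimage σ.left.continuous
  have hEne : σ.left.base ⁻¹' (U : Set X.left)ᶜ ≠ Set.univ := by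
    obtain ⟨x, hx⟩ := hU'.nonempty
    exact fun hu ↦ (hu ▸ Set.mem_univ x : x ∈ σ.left.base ⁻¹' (U : Set X.left)ᶜ) hx
  have hκN : singularCohomology.ringChange (Int.castRingHom ℂ) (ComplexPoints X') (2 * p) κ ∈
      supportedClasses X' (2 * p) 1 :=
    mem_supportedClasses_of_restrictCompl_eq_zero hE ((forall_one_le_coheight_iff_ne_univ hE).2 hEne) hA
  obtain ⟨E₁, hE₁, hE₁ne, N, hN, hNκ⟩ :=
    genericDivisibilityBounded_exists_nsmul_restrict_eq_zero_of_ringChange_mem_supportedClasses hX'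
      (show 1 ≤ 2 * p by omega) hκN
  -- `TorsionDiesGenerically` on `X'`: `κ` dies on a smaller non-empty Zariski open
  obtain ⟨E₂, hE₁₂, hE₂, hE₂ne, hκ0⟩ := hT hp hX' E₁ hE₁ hE₁ne (Res[X', E₁, 2 * p] κ) N hN hNκ
  have hκE₂ : Res[X', E₂, 2 * p] κ = 0 := by
    rw [← genericDivisibility_restrict_restrict ℤ hE₁₂ (2 * p) κ]
    exact hκ0
  -- `z ⊗ ℂ` is of type `(p,p)`; C1 at `X` for `z`, pulled back along the surjection `σ`
  have hzH : IsOfHodgeType (2 * p) X (2 * p) p p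
      (singularCohomology.ringChange (Int.castRingHom ℂ) (ComplexPoints X) (2 * p) z) :=
    isOfHodgeType_ringChange_gysinMap_complexOrientationInt hX' hX σ h2 z' hz'
  obtain ⟨Z₁, hZ₁, hZ₁ne, y₁, hy₁⟩ :=
    genericDivisibilityBounded_divisible_map σ hsurj (hC z hzH) m hm
  -- `z' = σ^* z + κ` on `(X' ∖ (Z₁ ∪ E₂))(ℂ)`
  refine ⟨Z₁ ∪ E₂, hZ₁.union hE₂, genericDivisibilityBounded_union_ne_univ hZ₁ hE₂ hZ₁ne hE₂ne,
    singularCohomology.map ℤ ℤ Incl[X', Z₁, Z₁ ∪ E₂, Set.subset_union_left] (2 * p) y₁, ?_⟩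
  have hz'eq : z' = singularCohomology.map ℤ ℤ (AlgPoints.mapContinuous (L := ℂ) σ) (2 * p) z + κ := by
    rw [hκ, add_sub_cancel]
  have hsum : Res[X', Z₁ ∪ E₂, 2 * p] z' =
      Res[X', Z₁ ∪ E₂, 2 * p] (singularCohomology.map ℤ ℤ (AlgPoints.mapContinuous (L := ℂ) σ) (2 * p) z) +
        Res[X', Z₁ ∪ E₂, 2 * p] κ := by
    rw [← map_add, ← hz'eq]
  rw [← map_nsmul, hy₁, genericDivisibility_restrict_restrict ℤ Set.subset_union_left, hsum,
    ← genericDivisibility_restrict_restrict ℤ (Set.subset_union_right (s := Z₁)) (2 * p) κ, hκE₂,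
    map_zero, add_zero]

/-- **Within the route, C1 is a birational invariant of smooth projective `2p`-folds**: granted
`TorsionDiesGenerically`, for `σ : X' ⟶ X` birational between smooth projective `2p`-folds, C1 holds
at `X'` iff it holds at `X` (`⇒` unconditional: `hodgeClassesGenericallyDivisible_of_isBirational`;
`⇐`: the previous theorem). [cite: VoisinHodgeI2002, §7.3.2 Lemma 7.28 and proof of Thm. 7.31]
[cite: ColliotTheleneVoisin2012, Thm. 3.1 and Prop. 3.4] -/
theorem hodgeClassesGenericallyDivisible_iff_of_isBirational_of_torsionDiesGenerically
    (hT : TorsionDiesGenerically) (hp : 1 ≤ p) (hX' : IsSmoothProjective (2 * p) X')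
    (hX : IsSmoothProjective (2 * p) X) (σ : X' ⟶ X)
    (hσ : Literature.AlgebraicGeometry.Resolution.IsBirational σ.left) :
    (∀ z' : singularCohomology ℤ ℤ (ComplexPoints X') (2 * p),
      IsOfHodgeType (2 * p) X' (2 * p) p p
          (singularCohomology.ringChange (Int.castRingHom ℂ) (ComplexPoints X') (2 * p) z') →
        ∀ m : ℕ, 1 ≤ m → ∃ Z : Set X'.left, IsClosed Z ∧ Z ≠ Set.univ ∧
          ∃ y : singularCohomology ℤ ℤ (complexPointsCompl X' Z) (2 * p),
            m • y = Res[X', Z, 2 * p] z') ↔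
    (∀ z : singularCohomology ℤ ℤ (ComplexPoints X) (2 * p),
      IsOfHodgeType (2 * p) X (2 * p) p p
          (singularCohomology.ringChange (Int.castRingHom ℂ) (ComplexPoints X) (2 * p) z) →
        ∀ m : ℕ, 1 ≤ m → ∃ Z : Set X.left, IsClosed Z ∧ Z ≠ Set.univ ∧
          ∃ y : singularCohomology ℤ ℤ (complexPointsCompl X Z) (2 * p),
            m • y = Res[X, Z, 2 * p] z) :=
  ⟨fun hC' z hz _ hm ↦ hodgeClassesGenericallyDivisible_of_isBirational hX' hX σ hσ hC' z hz hm,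
    fun hC z' hz' _ hm ↦
      hodgeClassesGenericallyDivisible_at_of_isBirational_up_of_torsionDiesGenerically hT hp hX' hX σ
        hσ hC z' hz' hm⟩

/-! ### The registered sub-goal -/

/-- **Registered sub-goal `stub_hodgeClassesGenericallyDivisible_of_isBirational_up` of
stmt-HodgeConjecture-18466: granted the route's `TorsionDiesGenerically`, the crux C1 ASCENDS along
birational morphisms of smooth projective `2p`-folds** (closed form; proof:
`hodgeClassesGenericallyDivisible_at_of_isBirational_up_of_torsionDiesGenerically`).
[cite: VoisinHodgeI2002, §7.3.2 Lemma 7.28 and proof of Thm. 7.31]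
[cite: ColliotTheleneVoisin2012, Thm. 3.1 and Prop. 3.4] -/
theorem stub_hodgeClassesGenericallyDivisible_of_isBirational_up :
    Summit.HodgeConjecture.HodgeConjecture.Theses.GenericDivisibility.TorsionDiesGenerically →
    ∀ ⦃p : ℕ⦄ ⦃X' X : SchemeOver ℂ⦄ (σ : X' ⟶ X), 1 ≤ p → IsSmoothProjective (2 * p) X' →
      IsSmoothProjective (2 * p) X → Literature.AlgebraicGeometry.Resolution.IsBirational σ.left →
      (∀ z : singularCohomology ℤ ℤ (ComplexPoints X) (2 * p),
        IsOfHodgeType (2 * p) X (2 * p) p p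
            (singularCohomology.ringChange (Int.castRingHom ℂ) (ComplexPoints X) (2 * p) z) →
          ∀ m : ℕ, 1 ≤ m → ∃ Z : Set X.left, IsClosed Z ∧ Z ≠ Set.univ ∧
            ∃ y : singularCohomology ℤ ℤ (complexPointsCompl X Z) (2 * p),
              m • y = singularCohomology.map ℤ ℤ
                (⟨Subtype.val, continuous_subtype_val⟩ :
                  C(complexPointsCompl X Z, ComplexPoints X)) (2 * p) z) →
      ∀ z' : singularCohomology ℤ ℤ (ComplexPoints X') (2 * p),
        IsOfHodgeType (2 * p) X' (2 * p) p p
            (singularCohomology.ringChange (Int.castRingHom ℂ) (ComplexPoints X') (2 * p) z') →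
          ∀ m : ℕ, 1 ≤ m → ∃ Z : Set X'.left, IsClosed Z ∧ Z ≠ Set.univ ∧
            ∃ y : singularCohomology ℤ ℤ (complexPointsCompl X' Z) (2 * p),
              m • y = singularCohomology.map ℤ ℤ
                (⟨Subtype.val, continuous_subtype_val⟩ :
                  C(complexPointsCompl X' Z, ComplexPoints X')) (2 * p) z' :=
  fun hT _ _ _ σ hp hX' hX hσ hC z' hz' _ hm ↦
    hodgeClassesGenericallyDivisible_at_of_isBirational_up_of_torsionDiesGenerically hT hp hX' hX σ hσ
      hC z' hz' hm

end Summit.HodgeConjecture.HodgeConjecture.Theorems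

end
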